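import Summits.ResolutionOfSingularities.ResolutionOfSingularities.Theorems.PurelyInseparableDim4PureLeafTransitionsPair
import HarnessLib
import HarnessLib.Audit.Tags

/-!
# Purely inseparable fourfolds — LEGALITY READINGS for the normal forms over `𝔽₂`
# (cell res-dim4-pi; D3b, items (R1)–(R2) of `HOME/res-dim4-p-10/D3b-PAPER.md` §4)
# [OURS · counted 0 · bookkeeping identities of OUR frame, not about resolution]

Width seat `res-dim4-p-10` (g2).  What an EQUIMULTIPLE, NON-ZERO reply of B tells about the exponents of the uncleaned
transform `F⁺ = N(a′,e′) = ∏ xᵢ^{a′ᵢ}(1+xᵢ)^{e′ᵢ}` (q = 2: equimultiple ⟺ no linear monomial,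
`PthPowerFactor.isEquimultiplePoint_two_iff`):

* (R1) linear coefficients: `coeff_single_prod_one_add` (`coeff x_i ∏(1+x_k)^{e_k} = e_i`), `coeff_single_prod_of_forall_zero`
  (`a′ = 0 ⇒ coeff x_i N(0,e′) = e′_i`), `coeff_single_prod_of_unit` (`a′ = δ_i ⇒ coeff x_i N = 1`);
* (R2) **`two_le_sum_of_equimultiple`**: if all linear coefficients of `N(a′,e′)` vanish and its cleaning is non-zero, then
  `2 ≤ Σ a′` — the transform is again `2`-fold at the origin with a genuine monomial part (neither `Σ a′ = 1`, nor the
  «all even» collapse `Σ a′ = 0` whose cleaning is `0`);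
* the packaged forms for the singleton move (`two_le_sum_singleton_of_edge`) and the pair move (`two_le_sum_pair_of_edge`)
  from the frame's `IsEquimultiplePoint` / `(step …).F ≠ 0`.

Nothing here proves resolution of singularities in dimension ≥ 4 / characteristic `p`; counted 0; AI work, weaker than
expert review. bears_on: LADDER-RESOLUTION:D157-DOOR2 (res-dim4-pi · WORD #60 D3b). Supports
stmt-ResolutionOfSingularities-16155 (helper).
-/

set_option linter.dupNamespace false

open MvPolynomial Finset

open scoped BigOperators

noncomputable section

namespace Summit.ResolutionOfSingularities.ResolutionOfSingularities.Theorems.PIDim4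

namespace PureLeafNF

open Literature.AlgebraicGeometry.Resolution
open Literature.AlgebraicGeometry.Resolution.Hauser2010
open CentreBlowup PthPowerFactor

variable {σ : Type*} [Fintype σ] [DecidableEq σ]

/-! ## 1. (R1) Linear coefficients of a normal form -/

/-- `coeff x_i (∏ (1+x_k)^{e_k}) = e_i`. [folklore] -/
theorem coeff_single_prod_one_add {K : Type*} [CommRing K] (e : σ → ℕ) (i : σ) :
    coeff (Finsupp.single i 1) (∏ k, (1 + X k) ^ e k : MvPolynomial σ K) = (e i : K) := by
  have h : (∏ k, (1 + X k) ^ e k : MvPolynomial σ K) = ∏ k, (X k + C ((fun _ => (1 : K)) k)) ^ e k := by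
    refine Finset.prod_congr rfl fun k _ => ?_
    rw [C_1, add_comm]
  rw [h, WeightedBlowup.coeff_prod_X_add_C_pow]
  rw [← Finset.mul_prod_erase Finset.univ _ (Finset.mem_univ i), Finsupp.single_eq_same, Nat.choose_one_right,
    one_pow, mul_one, Finset.prod_eq_one fun k hk => ?_, mul_one]
  rw [Finsupp.single_eq_of_ne (Finset.ne_of_mem_erase hk), Nat.choose_zero_right, Nat.cast_one, one_pow, mul_one]

omit [DecidableEq σ] in
/-- If `a = 0`: `coeff x_i N(0,e) = e_i`. [folklore] -/
theorem coeff_single_prod_of_forall_zero {K : Type*} [CommRing K] (a e : σ → ℕ) (ha : ∀ k, a k = 0) (i : σ) :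
    coeff (Finsupp.single i 1) (∏ k, X k ^ a k * (1 + X k) ^ e k : MvPolynomial σ K) = (e i : K) := by
  classical
  have h : (∏ k, X k ^ a k * (1 + X k) ^ e k : MvPolynomial σ K) = ∏ k, (1 + X k) ^ e k :=
    Finset.prod_congr rfl fun k _ => by rw [ha k, pow_zero, one_mul]
  rw [h, coeff_single_prod_one_add]

/-- If `a = δ_i`: `coeff x_i N(δ_i, e) = 1`. [folklore] -/
theorem coeff_single_prod_of_unit {K : Type*} [CommRing K] (a e : σ → ℕ) (i : σ) (hai : a i = 1)
    (ha : ∀ k, k ≠ i → a k = 0) :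
    coeff (Finsupp.single i 1) (∏ k, X k ^ a k * (1 + X k) ^ e k : MvPolynomial σ K) = 1 := by
  have hfs : Finsupp.equivFunOnFinite.symm a = Finsupp.single i 1 := by
    ext k
    rw [Finsupp.single_apply]
    by_cases hk : i = k
    · subst hk; rw [if_pos rfl]; exact hai
    · rw [if_neg hk]; exact ha k (Ne.symm hk)
  have h := coeff_self_prod (K := K) a e
  rwa [hfs] at h

/-! ## 2. (R2) What an equimultiple non-zero reply implies -/

omit [DecidableEq σ] in
/-- The exponent vector of a normal form with `Σ a = 1` is a unit vector. [folklore] -/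
theorem exists_unit_of_sum_eq_one (a : σ → ℕ) (h : ∑ k, a k = 1) : ∃ i, a i = 1 ∧ ∀ k, k ≠ i → a k = 0 := by
  classical
  obtain ⟨i, hi⟩ : ∃ i, a i ≠ 0 := by
    by_contra hne
    push Not at hne
    rw [Finset.sum_eq_zero fun k _ => hne k] at h
    exact absurd h (by norm_num)
  have hsplit := Finset.add_sum_erase Finset.univ a (Finset.mem_univ i)
  have hle : a i ≤ 1 := by rw [← h]; exact Finset.single_le_sum (fun k _ => Nat.zero_le _) (Finset.mem_univ i)
  refine ⟨i, by omega, fun k hk => ?_⟩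
  have hrest : ∑ k ∈ Finset.univ.erase i, a k = 0 := by omega
  exact Finset.sum_eq_zero_iff.mp hrest k (Finset.mem_erase.mpr ⟨hk, Finset.mem_univ k⟩)

/-- **(R2)** If every linear coefficient of `N(a,e)` vanishes (equimultiplicity at `q = 2`) and its cleaning is non-zero,
then `2 ≤ Σ a`. [folklore] -/
theorem two_le_sum_of_equimultiple (a e : σ → ℕ)
    (hlin : ∀ i, coeff (Finsupp.single i 1) (∏ k, X k ^ a k * (1 + X k) ^ e k : MvPolynomial σ (ZMod 2)) = 0)
    (hne : deletePthPowers 2 (∏ k, X k ^ a k * (1 + X k) ^ e k : MvPolynomial σ (ZMod 2)) ≠ 0) :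
    2 ≤ ∑ k, a k := by
  by_contra hlt
  rw [not_le] at hlt
  have h01 : ∑ k, a k = 0 ∨ ∑ k, a k = 1 := by omega
  rcases h01 with h0 | h1
  · -- `a = 0`: the linear coefficients are the parities of `e`, so `e` is even and the cleaning kills everything
    have ha : ∀ k, a k = 0 := fun k => Finset.sum_eq_zero_iff.mp h0 k (Finset.mem_univ k)
    have heven : ∀ i, e i % 2 = 0 := fun i => by
      have h := hlin i
      rw [coeff_single_prod_of_forall_zero a e ha] at h
      have h2 : ((e i : ℕ) : ZMod 2) = 0 := h
      rw [ZMod.natCast_eq_zero_iff] at h2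
      omega
    apply hne
    have hsq := sub_deletePthPowers_of_forall_even a e (fun i => by rw [ha i])
    have hsame : (∏ i, X i ^ a i * (1 + X i) ^ (e i - e i % 2) : MvPolynomial σ (ZMod 2)) =
        ∏ i, X i ^ a i * (1 + X i) ^ e i :=
      Finset.prod_congr rfl fun i _ => by rw [heven i, Nat.sub_zero]
    rw [hsame, sub_eq_self] at hsq
    exact hsq
  · obtain ⟨i, hai, hrest⟩ := exists_unit_of_sum_eq_one a h1
    have h := hlin i
    rw [coeff_single_prod_of_unit a e i hai hrest] at h
    exact one_ne_zero h

/-- **(R2, singleton move)**: an equimultiple non-zero reply `b` to the centre `{x_j}` at `N(a,e)` (`2 ≤ a_j`) has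
`2 ≤ Σ a′` for the chart-and-swap exponents `a′`. [folklore] -/
theorem two_le_sum_singleton_of_edge (s : CState σ (ZMod 2)) (a e : σ → ℕ)
    (hF : s.F = ∏ i, X i ^ a i * (1 + X i) ^ e i) {j : σ} (hj : 2 ≤ a j) (b : σ → ZMod 2)
    (heq : IsEquimultiplePoint 2 {j} j b s) (hne : (step 2 {j} j b s).F ≠ 0) :
    2 ≤ ∑ i, (if b i = 0 then Function.update a j (a j - 2) i else e i) := by
  rw [isEquimultiplePoint_two_iff, pointTransform_singleton s a e hF hj b] at heq
  change deletePthPowers 2 (pointTransform 2 {j} j b s) ≠ 0 at hne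
  rw [pointTransform_singleton s a e hF hj b] at hne
  exact two_le_sum_of_equimultiple _ _ heq hne

/-- **(R2, pair move)**: the same for the centre `{x_j, x_k}` at a state with pure `x_j`, `x_k`. [folklore] -/
theorem two_le_sum_pair_of_edge (s : CState σ (ZMod 2)) (a e : σ → ℕ)
    (hF : s.F = ∏ i, X i ^ a i * (1 + X i) ^ e i) {j k : σ} (hjk : j ≠ k) (haj : a j = 1) (hak : a k = 1)
    (hej : e j = 0) (hek : e k = 0) (b : σ → ZMod 2)
    (heq : IsEquimultiplePoint 2 {j, k} j b s) (hne : (step 2 {j, k} j b s).F ≠ 0) :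
    2 ≤ ∑ i, (if b i = 0 then Function.update a j 0 i else e i) := by
  rw [isEquimultiplePoint_two_iff, pointTransform_pair s a e hF hjk haj hak hej hek b] at heq
  change deletePthPowers 2 (pointTransform 2 {j, k} j b s) ≠ 0 at hne
  rw [pointTransform_pair s a e hF hjk haj hak hej hek b] at hne
  exact two_le_sum_of_equimultiple _ _ heq hne

end PureLeafNF

end Summit.ResolutionOfSingularities.ResolutionOfSingularities.Theorems.PIDim4

end
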